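import Summits.ValiantsHypothesis.ValiantsHypothesis.Theorems.BarrierLeverChowHitsPartitionMinorsRefutation
import Summits.ValiantsHypothesis.ValiantsHypothesis.Theorems.BarrierLeverPartitionMinorsChowSymmetricForms

/-!
# Route BarrierLever — REFUTATION of item `ChowHitsSymmetricForms` (stmt-ValiantsHypothesis-20507)

Prover file (cell valiant-natproofs, rung V4, 𝒟-side; seat val-np-p2 gen 10; pre-authorised by planner
valiant-natproofs-p1 g19, STATUS 2026-08-27T22:16:14Z).  **Closes item 20507 NEGATIVELY** by composition
of two landed theorems: the planner's arrow
`ChowFactor.chowHitsPartitionMinors_of_symmetricForms : ChowHitsSymmetricForms-text → ChowHitsPartitionMinors`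
(p531518; products of `h + h` affine forms symmetric under `x_a ↔ y_a` are in particular products of
`h + h` affine forms) and the refutation `ChowStarve.not_ChowHitsPartitionMinors` (p576926; item 20172
is false from `h = 25` on by quadratic-direction starvation of the thin-row dense regime, memo
HOME/val-np-p2/g9/REFUTATION-20195-valnp2-g9.md).

Classification (for the planner): refuted-misstated, same class as 20172/20195 — the witness exploits the
budget `h + h` of affine forms; the repaired statements with `h * h` forms are items 21850 / 21882.

WHAT THIS IS NOT: nothing on item 19717 `PartitionMinorsHitByVP`, on crux stmt-ValiantsHypothesis-14610,
or on `VP` versus `VNP`.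
-/

set_option linter.dupNamespace false

namespace Summit.ValiantsHypothesis.ValiantsHypothesis.Theorems.BarrierLever.ChowStarve

/-- **Item `ChowHitsSymmetricForms` (stmt-ValiantsHypothesis-20507) is FALSE**: a symmetric-forms
witness is a `ChowHitsPartitionMinors` witness (arrow `chowHitsPartitionMinors_of_symmetricForms`),
and `ChowHitsPartitionMinors` (item 20172) is false (`not_ChowHitsPartitionMinors`).
refuted-misstated: the budget `h + h` of affine forms is what the starvation witness exploits; the
repaired form with `h * h` affine forms is item 21882 `ChowHitsPartitionMinorsR`. -/
theorem not_ChowHitsSymmetricForms :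
    ¬ Summit.ValiantsHypothesis.ValiantsHypothesis.Theses.BarrierLever.ChowHitsSymmetricForms :=
  fun H => not_ChowHitsPartitionMinors (ChowFactor.chowHitsPartitionMinors_of_symmetricForms H)

end Summit.ValiantsHypothesis.ValiantsHypothesis.Theorems.BarrierLever.ChowStarve
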